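import Summits.FinalStateConjecture.FinalStateConjecture.Theorems.EIHFluxBalanceInertialRecessionVirialVisitFlyby

/-!
# Route EIHFluxBalance — crux `InertialRecession`, abstract endgame for general `N`:
# the FLY-BY lemma on a whole far phase (toward LEMMA SPLIT, block L5a)

Helper file for the crux `stmt-FinalStateConjecture-10166` (virial route, `work/split/PLAN.md`, N = 3 doubly-bad case).
Mathlib-only. `flyby_far`: as `flyby` but along a whole far phase `[j₁, j₂]` of a third pair: the single-body windows have radius
`min(d, 2θs)/3` (so the partner `c` of `a` may be far), every other body is beyond `min(d, 2θs)/2`, and the budget gains the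
linear tail `2(2θ)^{-3/2} j₁^{-1/2}`: if `u = v_c − v_a` is FAST at `j₁` then it stays `U/8`-coherent and `v_a` is frozen up to the
kick `6(|C|·3^{3/2}(6r_m^{-1/2}/(3U/4) + 2(2θ)^{-3/2}j₁^{-1/2}) + 2Z)/M_a` on the whole phase.
-/

noncomputable section

open Finset Filter Topology MeasureTheory intervalIntegral Set

namespace Summit.FinalStateConjecture.FinalStateConjecture.Theorems.SublinearIsFree.Virial

open Literature.Geometry.Lorentzian

variable {N : ℕ}

/-- **The fly-by lemma on a whole far phase** (radius `min(d, 2θs)/3`; see the module docstring). [folklore] -/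
theorem flyby_far (M : Fin N → ℝ) (ξ v : Fin N → ℝ → E3) (κ : ℝ) (P : ℝ → E3 → ℝ → Fin 4 → ℝ)
    (ρ : ℝ → ℝ) (C T T' T₀ : ℝ) (ζ : ℝ → ℝ)
    (hWL : ∀ (t₁ t₂ : ℝ) (c : ℝ → E3) (R : ℝ → ℝ), T ≤ t₁ → t₁ ≤ t₂ →
      (∀ s ∈ Set.Icc t₁ t₂, ∀ s' ∈ Set.Icc t₁ t₂, ‖c s - c s'‖ ≤ 2 * |s - s'| ∧ |R s - R s'| ≤ 2 * |s - s'|) →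
      (∀ s ∈ Set.Icc t₁ t₂, ρ s ≤ (1 / 2) * R s ∧ ‖c s‖ + R s ≤ (κ + κ ^ 2) / 2 * s ∧
        ∀ j, ‖ξ j s - c s‖ ≤ (1 - 1 / 2) * R s ∨ (1 + 1 / 2) * R s ≤ ‖ξ j s - c s‖) →
      ∀ μ : Fin 4, |P t₂ (c t₂) (R t₂) μ - P t₁ (c t₁) (R t₁) μ| ≤ C * ∫ s in t₁..t₂, (R s ^ (3 / 2 : ℝ))⁻¹)
    (hID : ∀ (t : ℝ) (c : E3) (R : ℝ) (A : Finset (Fin N)), T' ≤ t → ρ t ≤ (1 / 2) * R →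
      ‖c‖ + R ≤ (κ + κ ^ 2) / 2 * t →
      (∀ j, ‖ξ j t - c‖ ≤ (1 - 1 / 2) * R ∨ (1 + 1 / 2) * R ≤ ‖ξ j t - c‖) →
      (∀ j, j ∈ A ↔ ‖ξ j t - c‖ ≤ (1 - 1 / 2) * R) →
      |P t c R 0 - ∑ j ∈ A, M j * (√(1 - ‖v j t‖ ^ 2))⁻¹| ≤ ζ t ∧
      ∀ k : Fin 3, |P t c R k.succ - ∑ j ∈ A, M j * (√(1 - ‖v j t‖ ^ 2))⁻¹ * v j t k| ≤ ζ t)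
    (hdiff : ∀ i, Differentiable ℝ (ξ i)) (hspeed : ∀ i s, T₀ ≤ s → ‖deriv (ξ i) s‖ ≤ 2) (hvcont : ∀ i, Continuous (v i))
    {a c : Fin N} (hMa : 0 < M a) (hMc : 0 < M c) (hv1 : ∀ x t, ‖v x t‖ < 1)
    {j₁ j₂ rm Fe₀ Z θ : ℝ} (hT : T ≤ j₁) (hT' : T' ≤ j₁) (hT₀ : T₀ ≤ j₁) (hj0 : 0 < j₁) (h12 : j₁ ≤ j₂) (hrm : 0 < rm)
    (hθ : 0 < θ) (hθ1 : θ ≤ 1)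
    (hrmd : ∀ s ∈ Icc j₁ j₂, rm ≤ ‖ξ c s - ξ a s‖)
    (hρ : ∀ s ∈ Icc j₁ j₂, ρ s ≤ min ‖ξ c s - ξ a s‖ (2 * θ * s) / 6)
    (hcapa : ∀ s ∈ Icc j₁ j₂, ‖ξ a s‖ + min ‖ξ c s - ξ a s‖ (2 * θ * s) / 3 ≤ (κ + κ ^ 2) / 2 * s)
    (hcapc : ∀ s ∈ Icc j₁ j₂, ‖ξ c s‖ + min ‖ξ c s - ξ a s‖ (2 * θ * s) / 3 ≤ (κ + κ ^ 2) / 2 * s)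
    (hothers : ∀ s ∈ Icc j₁ j₂, ∀ y, y ≠ a → y ≠ c →
      min ‖ξ c s - ξ a s‖ (2 * θ * s) / 2 ≤ ‖ξ y s - ξ a s‖ ∧ min ‖ξ c s - ξ a s‖ (2 * θ * s) / 2 ≤ ‖ξ y s - ξ c s‖)
    (hsl : ∀ s ∈ Icc j₁ j₂, ‖deriv (ξ a) s - v a s‖ ≤ Fe₀ ∧ ‖deriv (ξ c) s - v c s‖ ≤ Fe₀)
    (hζZ : ∀ s ∈ Icc j₁ j₂, ζ s ≤ Z) (hZ : 0 ≤ Z)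
    (hUpos : 0 < ‖v c j₁ - v a j₁‖) (hFe : 2 * Fe₀ ≤ ‖v c j₁ - v a j₁‖ / 8)
    (hkick : (6 / M a + 6 / M c) *
      (|C| * ((3 : ℝ) ^ (3 / 2 : ℝ) * (6 * (rm ^ (1 / 2 : ℝ))⁻¹ / (3 * ‖v c j₁ - v a j₁‖ / 4) +
        2 * ((2 * θ) ^ (3 / 2 : ℝ))⁻¹ * (j₁ ^ (1 / 2 : ℝ))⁻¹)) + 2 * Z) ≤ ‖v c j₁ - v a j₁‖ / 16) :
    (∀ s ∈ Icc j₁ j₂, ‖(v c s - v a s) - (v c j₁ - v a j₁)‖ ≤ ‖v c j₁ - v a j₁‖ / 8) ∧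
    ∀ s ∈ Icc j₁ j₂, ‖v a s - v a j₁‖ ≤
      6 * (|C| * ((3 : ℝ) ^ (3 / 2 : ℝ) * (6 * (rm ^ (1 / 2 : ℝ))⁻¹ / (3 * ‖v c j₁ - v a j₁‖ / 4) +
        2 * ((2 * θ) ^ (3 / 2 : ℝ))⁻¹ * (j₁ ^ (1 / 2 : ℝ))⁻¹)) + 2 * Z) / M a := by
  -- notation
  obtain ⟨u₀, hu₀⟩ : ∃ u₀ : E3, u₀ = v c j₁ - v a j₁ := ⟨_, rfl⟩
  obtain ⟨U, hU⟩ : ∃ U : ℝ, U = ‖v c j₁ - v a j₁‖ := ⟨_, rfl⟩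
  rw [← hU] at hUpos hFe hkick ⊢
  rw [← hu₀]
  have hUu : ‖u₀‖ = U := by rw [hu₀, hU]
  obtain ⟨bud, hbud⟩ : ∃ bud : ℝ, bud = (3 : ℝ) ^ (3 / 2 : ℝ) * (6 * (rm ^ (1 / 2 : ℝ))⁻¹ / (3 * U / 4) +
      2 * ((2 * θ) ^ (3 / 2 : ℝ))⁻¹ * (j₁ ^ (1 / 2 : ℝ))⁻¹) := ⟨_, rfl⟩
  rw [← hbud] at hkick ⊢
  have hbud0 : 0 ≤ bud := by rw [hbud]; positivity
  obtain ⟨kick, hkickdef⟩ : ∃ k : ℝ, k = |C| * bud + 2 * Z := ⟨_, rfl⟩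
  rw [← hkickdef] at hkick ⊢
  have hkick0 : 0 ≤ kick := by rw [hkickdef]; positivity
  -- the relative position and its derivative
  obtain ⟨r, hrdef⟩ : ∃ r : ℝ → E3, r = fun s ↦ ξ c s - ξ a s := ⟨_, rfl⟩
  have hrap : ∀ s, r s = ξ c s - ξ a s := fun s ↦ by rw [hrdef]
  have hrd : Differentiable ℝ r := by rw [hrdef]; exact (hdiff c).sub (hdiff a)
  have hrder : ∀ s, deriv r s = deriv (ξ c) s - deriv (ξ a) s := fun s ↦ by
    rw [hrdef]; exact deriv_sub (hdiff c s) (hdiff a s)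
  have hj0' : ∀ s ∈ Icc j₁ j₂, T₀ ≤ s := fun s hs ↦ hT₀.trans hs.1
  -- the radius `d/3` is 2-Lipschitz and the windows are admissible
  have hlip2 : ∀ i, ∀ s ∈ Icc j₁ j₂, ∀ s' ∈ Icc j₁ j₂, ‖ξ i s - ξ i s'‖ ≤ 2 * |s - s'| := fun i s hs s' hs' ↦
    Endgame.lipschitz_two_of_deriv (hdiff i) (fun t ht ↦ hspeed i t ht) (hj0' s hs) (hj0' s' hs')
  have hRlip : ∀ s ∈ Icc j₁ j₂, ∀ s' ∈ Icc j₁ j₂,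
      |min ‖ξ c s - ξ a s‖ (2 * θ * s) / 3 - min ‖ξ c s' - ξ a s'‖ (2 * θ * s') / 3| ≤ 2 * |s - s'| := by
    intro s hs s' hs'
    have h1 : |‖ξ c s - ξ a s‖ - ‖ξ c s' - ξ a s'‖| ≤ ‖(ξ c s - ξ a s) - (ξ c s' - ξ a s')‖ := abs_norm_sub_norm_le _ _
    have h2 : ‖(ξ c s - ξ a s) - (ξ c s' - ξ a s')‖ ≤ ‖ξ c s - ξ c s'‖ + ‖ξ a s - ξ a s'‖ := by
      calc ‖(ξ c s - ξ a s) - (ξ c s' - ξ a s')‖ = ‖(ξ c s - ξ c s') - (ξ a s - ξ a s')‖ := by congr 1; abel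
        _ ≤ ‖ξ c s - ξ c s'‖ + ‖ξ a s - ξ a s'‖ := norm_sub_le _ _
    have h3 := hlip2 c s hs s' hs'
    have h4 := hlip2 a s hs s' hs'
    have h5 : |min ‖ξ c s - ξ a s‖ (2 * θ * s) - min ‖ξ c s' - ξ a s'‖ (2 * θ * s')| ≤
        max |‖ξ c s - ξ a s‖ - ‖ξ c s' - ξ a s'‖| |2 * θ * s - 2 * θ * s'| := abs_min_sub_min_le_max _ _ _ _
    have h6 : |2 * θ * s - 2 * θ * s'| = 2 * θ * |s - s'| := by
      rw [← mul_sub, abs_mul, abs_of_pos (by positivity)]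
    have h7 : max |‖ξ c s - ξ a s‖ - ‖ξ c s' - ξ a s'‖| |2 * θ * s - 2 * θ * s'| ≤ 4 * |s - s'| := by
      refine max_le (by linarith) ?_
      rw [h6]; nlinarith [abs_nonneg (s - s')]
    rw [← sub_div, abs_div, abs_of_pos (by norm_num : (0 : ℝ) < 3)]
    rw [div_le_iff₀ (by norm_num : (0 : ℝ) < 3)]
    linarith [abs_nonneg (s - s')]
  have hminpos : ∀ s ∈ Icc j₁ j₂, 0 < min ‖ξ c s - ξ a s‖ (2 * θ * s) := fun s hs ↦
    lt_min (hrm.trans_le (hrmd s hs)) (by have : 0 < s := hj0.trans_le hs.1; positivity)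
  -- THE KEY STEP: if `u` is `U/8`-close to `u₀` on `[j₁, s]` then the budget on `[j₁, s]` is `≤ bud`
  have key : ∀ s ∈ Icc j₁ j₂, (∀ s' ∈ Icc j₁ s, ‖(v c s' - v a s') - u₀‖ ≤ U / 8) →
      (∫ s' in j₁..s, ((min ‖ξ c s' - ξ a s'‖ (2 * θ * s') / 3) ^ (3 / 2 : ℝ))⁻¹) ≤ bud := by
    intro s hs hclose
    have hj₁s : j₁ ≤ s := hs.1
    -- the derivative of `r` is `U/4`-close to `u₀`
    have hder : ∀ s' ∈ Icc j₁ s, ‖deriv r s' - u₀‖ ≤ U / 4 := by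
      intro s' hs'
      have hs'' : s' ∈ Icc j₁ j₂ := ⟨hs'.1, hs'.2.trans hs.2⟩
      have h1 := hclose s' hs'
      have h2 := hsl s' hs''
      calc ‖deriv r s' - u₀‖
          = ‖(deriv (ξ c) s' - v c s') - (deriv (ξ a) s' - v a s') + ((v c s' - v a s') - u₀)‖ := by
            rw [hrder]; congr 1; abel
        _ ≤ ‖deriv (ξ c) s' - v c s'‖ + ‖deriv (ξ a) s' - v a s'‖ + ‖(v c s' - v a s') - u₀‖ :=
            (norm_add_le _ _).trans (add_le_add (norm_sub_le _ _) le_rfl)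
        _ ≤ U / 4 := by linarith [h2.1, h2.2]
    -- the coordinate along `u₀` advances at rate `≥ 3U/4`
    obtain ⟨e, hedef⟩ : ∃ e : E3, e = U⁻¹ • u₀ := ⟨_, rfl⟩
    have he1 : ‖e‖ = 1 := by rw [hedef, norm_smul, Real.norm_eq_abs, abs_of_pos (inv_pos.mpr hUpos), hUu, inv_mul_cancel₀ hUpos.ne']
    have heu : inner ℝ u₀ e = U := by
      rw [hedef, real_inner_smul_right, real_inner_self_eq_norm_sq, hUu]; field_simp
    obtain ⟨x, hxdef⟩ : ∃ x : ℝ → ℝ, x = fun t ↦ inner ℝ (r t) e := ⟨_, rfl⟩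
    have hxder : ∀ t, HasDerivAt x (inner ℝ (deriv r t) e) t := fun t ↦ by
      rw [hxdef]
      have h := (hrd t).hasDerivAt.inner (𝕜 := ℝ) (hasDerivAt_const t e)
      simpa using h
    have hrc' : Continuous r := hrd.continuous
    have hxcont : Continuous x := by rw [hxdef]; fun_prop
    have hxrate : ∀ t ∈ Icc j₁ s, 3 * U / 4 ≤ deriv x t := fun t ht ↦ by
      rw [(hxder t).deriv]
      have h1 : inner ℝ (deriv r t) e = U + inner ℝ (deriv r t - u₀) e := by
        rw [inner_sub_left, heu]; ring
      have h2 : |inner ℝ (deriv r t - u₀) e| ≤ ‖deriv r t - u₀‖ * ‖e‖ := abs_real_inner_le_norm _ _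
      rw [he1, mul_one] at h2
      have h3 := hder t ht
      have h4 := neg_abs_le (inner ℝ (deriv r t - u₀) e)
      linarith
    have hmono : ∀ t ∈ Icc j₁ s, ∀ t' ∈ Icc j₁ s, t ≤ t' → 3 * U / 4 * (t' - t) ≤ x t' - x t :=
      (convex_Icc j₁ s).mul_sub_le_image_sub_of_le_deriv hxcont.continuousOn
        (fun t _ ↦ (hxder t).differentiableAt.differentiableWithinAt)
        (fun t ht ↦ hxrate t (interior_subset ht))
    obtain ⟨m, -, hm⟩ := exists_abs_ge_mul_abs_sub hj₁s (by positivity : 0 < 3 * U / 4) hxcont.continuousOn hmono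
    -- hence `d ≥ max(rm, (3U/4)|t - m|)` and the pointwise budget bound
    have hdlow : ∀ t ∈ Icc j₁ s, max rm (3 * U / 4 * |t - m|) ≤ ‖ξ c t - ξ a t‖ := fun t ht ↦ by
      refine max_le (hrmd t ⟨ht.1, ht.2.trans hs.2⟩) ((hm t ht).trans ?_)
      have h1 : |x t| ≤ ‖r t‖ * ‖e‖ := by rw [hxdef]; exact abs_real_inner_le_norm _ _
      rwa [he1, mul_one, hrap] at h1
    have hpt : ∀ t ∈ Icc j₁ s, ((min ‖ξ c t - ξ a t‖ (2 * θ * t) / 3) ^ (3 / 2 : ℝ))⁻¹ ≤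
        (3 : ℝ) ^ (3 / 2 : ℝ) * ((max rm (3 * U / 4 * |t - m|)) ^ (3 / 2 : ℝ))⁻¹ +
        (3 : ℝ) ^ (3 / 2 : ℝ) * (((2 * θ) * t) ^ (3 / 2 : ℝ))⁻¹ := fun t ht ↦ by
      have ht' : t ∈ Icc j₁ j₂ := ⟨ht.1, ht.2.trans hs.2⟩
      have hmax0 : 0 < max rm (3 * U / 4 * |t - m|) := hrm.trans_le (le_max_left _ _)
      have ht0 : 0 < t := hj0.trans_le ht.1
      have hθt : 0 < 2 * θ * t := by positivity
      have h1 := hdlow t ht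
      have h33 : (0 : ℝ) < 3 ^ (3 / 2 : ℝ) := by positivity
      rcases le_total ‖ξ c t - ξ a t‖ (2 * θ * t) with hle | hle
      · rw [min_eq_left hle]
        have h2 : ((‖ξ c t - ξ a t‖ / 3) ^ (3 / 2 : ℝ))⁻¹ ≤ ((max rm (3 * U / 4 * |t - m|) / 3) ^ (3 / 2 : ℝ))⁻¹ :=
          inv_anti₀ (Real.rpow_pos_of_pos (div_pos hmax0 (by norm_num)) _)
            (Real.rpow_le_rpow (div_pos hmax0 (by norm_num)).le (by linarith) (by norm_num))
        have h3 : ((max rm (3 * U / 4 * |t - m|) / 3) ^ (3 / 2 : ℝ))⁻¹ =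
            (3 : ℝ) ^ (3 / 2 : ℝ) * ((max rm (3 * U / 4 * |t - m|)) ^ (3 / 2 : ℝ))⁻¹ := by
          rw [Real.div_rpow hmax0.le (by norm_num), inv_div, div_eq_mul_inv]
        have h4 : 0 ≤ (3 : ℝ) ^ (3 / 2 : ℝ) * (((2 * θ) * t) ^ (3 / 2 : ℝ))⁻¹ := by positivity
        linarith [h3.le]
      · rw [min_eq_right hle]
        have h3 : ((2 * θ * t / 3) ^ (3 / 2 : ℝ))⁻¹ = (3 : ℝ) ^ (3 / 2 : ℝ) * (((2 * θ) * t) ^ (3 / 2 : ℝ))⁻¹ := by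
          rw [Real.div_rpow hθt.le (by norm_num), inv_div, div_eq_mul_inv]
        have h4 : 0 ≤ (3 : ℝ) ^ (3 / 2 : ℝ) * ((max rm (3 * U / 4 * |t - m|)) ^ (3 / 2 : ℝ))⁻¹ := by positivity
        linarith [h3.le]
    -- integrate
    have hcont1 : ContinuousOn (fun t ↦ ((min ‖ξ c t - ξ a t‖ (2 * θ * t) / 3) ^ (3 / 2 : ℝ))⁻¹) (Icc j₁ s) := by
      refine ContinuousOn.inv₀ ?_ fun t ht ↦ (Real.rpow_pos_of_pos ?_ _).ne'
      · refine ContinuousOn.rpow_const ?_ fun t ht ↦ Or.inl ?_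
        · exact (((((hdiff c).continuous.sub (hdiff a).continuous).norm).min (by fun_prop)).div_const 3).continuousOn
        · exact (div_pos (hminpos t ⟨ht.1, ht.2.trans hs.2⟩) (by norm_num)).ne'
      · exact div_pos (hminpos t ⟨ht.1, ht.2.trans hs.2⟩) (by norm_num)
    have hcont2 : ContinuousOn (fun t ↦ (3 : ℝ) ^ (3 / 2 : ℝ) * ((max rm (3 * U / 4 * |t - m|)) ^ (3 / 2 : ℝ))⁻¹ +
        (3 : ℝ) ^ (3 / 2 : ℝ) * (((2 * θ) * t) ^ (3 / 2 : ℝ))⁻¹) (Icc j₁ s) := by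
      refine ContinuousOn.add ?_ ?_
      · refine (continuousOn_const.mul (ContinuousOn.inv₀ ?_ fun t _ ↦
          (Real.rpow_pos_of_pos (hrm.trans_le (le_max_left _ _)) _).ne'))
        exact (Continuous.continuousOn (by fun_prop)).rpow_const fun t _ ↦
          Or.inl (hrm.trans_le (le_max_left _ _)).ne'
      · refine (continuousOn_const.mul (ContinuousOn.inv₀ ?_ fun t ht ↦
          (Real.rpow_pos_of_pos (by have : 0 < t := hj0.trans_le ht.1; positivity) _).ne'))
        exact (Continuous.continuousOn (by fun_prop)).rpow_const fun t ht ↦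
          Or.inl (by have : 0 < t := hj0.trans_le ht.1; positivity)
    have hI1 : ∫ s' in j₁..s, ((max rm (3 * U / 4 * |s' - m|)) ^ (3 / 2 : ℝ))⁻¹ ≤ 6 * (rm ^ (1 / 2 : ℝ))⁻¹ / (3 * U / 4) :=
      integral_inv_rpow_max_le hrm (by positivity) hj₁s
    have hI2 : ∫ s' in j₁..s, (((2 * θ) * s') ^ (3 / 2 : ℝ))⁻¹ ≤ 2 * ((2 * θ) ^ (3 / 2 : ℝ))⁻¹ * (j₁ ^ (1 / 2 : ℝ))⁻¹ :=
      Endgame.integral_inv_rpow_three_halves_mul_le (by positivity) hj0 hj₁s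
    have hci1 : IntervalIntegrable (fun s' ↦ ((max rm (3 * U / 4 * |s' - m|)) ^ (3 / 2 : ℝ))⁻¹) volume j₁ s := by
      refine (ContinuousOn.inv₀ ?_ fun t _ ↦ (Real.rpow_pos_of_pos (hrm.trans_le (le_max_left _ _)) _).ne').intervalIntegrable_of_Icc hj₁s
      exact (Continuous.continuousOn (by fun_prop)).rpow_const fun t _ ↦ Or.inl (hrm.trans_le (le_max_left _ _)).ne'
    have hci2 : IntervalIntegrable (fun s' ↦ (((2 * θ) * s') ^ (3 / 2 : ℝ))⁻¹) volume j₁ s := by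
      refine (ContinuousOn.inv₀ ?_ fun t ht ↦ (Real.rpow_pos_of_pos ?_ _).ne').intervalIntegrable_of_Icc hj₁s
      · exact (Continuous.continuousOn (by fun_prop)).rpow_const fun t ht ↦
          Or.inl (by have : 0 < t := hj0.trans_le ht.1; positivity)
      · have : 0 < t := hj0.trans_le ht.1; positivity
    calc ∫ s' in j₁..s, ((min ‖ξ c s' - ξ a s'‖ (2 * θ * s') / 3) ^ (3 / 2 : ℝ))⁻¹
        ≤ ∫ s' in j₁..s, ((3 : ℝ) ^ (3 / 2 : ℝ) * ((max rm (3 * U / 4 * |s' - m|)) ^ (3 / 2 : ℝ))⁻¹ +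
            (3 : ℝ) ^ (3 / 2 : ℝ) * (((2 * θ) * s') ^ (3 / 2 : ℝ))⁻¹) :=
          intervalIntegral.integral_mono_on hj₁s (hcont1.intervalIntegrable_of_Icc hj₁s)
            (hcont2.intervalIntegrable_of_Icc hj₁s) hpt
      _ = (3 : ℝ) ^ (3 / 2 : ℝ) * (∫ s' in j₁..s, ((max rm (3 * U / 4 * |s' - m|)) ^ (3 / 2 : ℝ))⁻¹) +
            (3 : ℝ) ^ (3 / 2 : ℝ) * ∫ s' in j₁..s, (((2 * θ) * s') ^ (3 / 2 : ℝ))⁻¹ := by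
          rw [intervalIntegral.integral_add (hci1.const_mul _) (hci2.const_mul _),
            intervalIntegral.integral_const_mul, intervalIntegral.integral_const_mul]
      _ ≤ (3 : ℝ) ^ (3 / 2 : ℝ) * (6 * (rm ^ (1 / 2 : ℝ))⁻¹ / (3 * U / 4)) +
            (3 : ℝ) ^ (3 / 2 : ℝ) * (2 * ((2 * θ) ^ (3 / 2 : ℝ))⁻¹ * (j₁ ^ (1 / 2 : ℝ))⁻¹) :=
          add_le_add (mul_le_mul_of_nonneg_left hI1 (by positivity)) (mul_le_mul_of_nonneg_left hI2 (by positivity))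
      _ = bud := by rw [hbud]; ring
  -- velocity increments from the key step
  have hinca : ∀ s ∈ Icc j₁ j₂, (∀ s' ∈ Icc j₁ s, ‖(v c s' - v a s') - u₀‖ ≤ U / 8) →
      ‖v a s - v a j₁‖ ≤ 6 * kick / M a ∧ ‖v c s - v c j₁‖ ≤ 6 * kick / M c := by
    intro s hs hclose
    have hj₁s : j₁ ≤ s := hs.1
    have hsub : ∀ s' ∈ Icc j₁ s, s' ∈ Icc j₁ j₂ := fun s' hs' ↦ ⟨hs'.1, hs'.2.trans hs.2⟩
    have hb := key s hs hclose
    have hint0 : 0 ≤ ∫ s' in j₁..s, ((min ‖ξ c s' - ξ a s'‖ (2 * θ * s') / 3) ^ (3 / 2 : ℝ))⁻¹ :=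
      intervalIntegral.integral_nonneg hj₁s fun s' hs' ↦
        (inv_pos.mpr (Real.rpow_pos_of_pos (div_pos (hminpos s' (hsub s' hs')) (by norm_num)) _)).le
    have hCb : C * (∫ s' in j₁..s, ((min ‖ξ c s' - ξ a s'‖ (2 * θ * s') / 3) ^ (3 / 2 : ℝ))⁻¹) + ζ j₁ + ζ s ≤ kick := by
      rw [hkickdef]
      have h1 : C * (∫ s' in j₁..s, ((min ‖ξ c s' - ξ a s'‖ (2 * θ * s') / 3) ^ (3 / 2 : ℝ))⁻¹) ≤ |C| * bud :=
        (mul_le_mul_of_nonneg_right (le_abs_self C) hint0).trans (mul_le_mul_of_nonneg_left hb (abs_nonneg C))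
      linarith [hζZ j₁ ⟨le_rfl, h12⟩, hζZ s hs]
    constructor
    · have h := velocity_increment_of_windowPath M ξ v κ P ρ C T T' T₀ ζ hWL hID hdiff hspeed hMa (hv1 a)
        (R := fun t ↦ min ‖ξ c t - ξ a t‖ (2 * θ * t) / 3) hT hT' hT₀ hj₁s
        (fun t ht t' ht' ↦ hRlip t (hsub t ht) t' (hsub t' ht'))
        (fun t ht ↦ div_pos (hminpos t (hsub t ht)) (by norm_num))
        (fun t ht ↦ by have := hρ t (hsub t ht); linarith)
        (fun t ht ↦ hcapa t (hsub t ht))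
        (fun t ht j hj ↦ by
          by_cases hjc : j = c
          · rw [hjc]
            have := min_le_left ‖ξ c t - ξ a t‖ (2 * θ * t)
            linarith [(hminpos t (hsub t ht)).le]
          · exact le_trans (by linarith) (hothers t (hsub t ht) j hj hjc).1)
      exact h.trans (by rw [div_le_div_iff_of_pos_right hMa]; linarith)
    · have h := velocity_increment_of_windowPath M ξ v κ P ρ C T T' T₀ ζ hWL hID hdiff hspeed hMc (hv1 c)
        (R := fun t ↦ min ‖ξ c t - ξ a t‖ (2 * θ * t) / 3) hT hT' hT₀ hj₁s
        (fun t ht t' ht' ↦ hRlip t (hsub t ht) t' (hsub t' ht'))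
        (fun t ht ↦ div_pos (hminpos t (hsub t ht)) (by norm_num))
        (fun t ht ↦ by have := hρ t (hsub t ht); linarith)
        (fun t ht ↦ hcapc t (hsub t ht))
        (fun t ht j hj ↦ by
          by_cases hja : j = a
          · rw [hja]
            have e : ‖ξ a t - ξ c t‖ = ‖ξ c t - ξ a t‖ := norm_sub_rev _ _
            rw [e]
            linarith [min_le_left ‖ξ c t - ξ a t‖ (2 * θ * t), (hminpos t (hsub t ht)).le]
          · exact le_trans (by linarith) (hothers t (hsub t ht) j hja hj).2)
      exact h.trans (by rw [div_le_div_iff_of_pos_right hMc]; linarith)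
  -- continuous induction on the closed set `S = {‖u − u₀‖ ≤ U/8}`
  obtain ⟨S, hSdef⟩ : ∃ S : Set ℝ, S = {s | ‖(v c s - v a s) - u₀‖ ≤ U / 8} := ⟨_, rfl⟩
  have hmemS : ∀ s, s ∈ S ↔ ‖(v c s - v a s) - u₀‖ ≤ U / 8 := fun s ↦ by rw [hSdef]; rfl
  have hSc : IsClosed S := by
    rw [hSdef]
    exact isClosed_le (by fun_prop) continuous_const
  have hj₁S : j₁ ∈ S := by
    rw [hmemS, hu₀, sub_self, norm_zero]; positivity
  have hind : Icc j₁ j₂ ⊆ S := by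
    refine (hSc.inter isClosed_Icc).Icc_subset_of_forall_mem_nhdsGT_of_Icc_subset hj₁S fun s hs hsub ↦ ?_
    have hs' : s ∈ Icc j₁ j₂ := ⟨hs.1, hs.2.le⟩
    have hclose : ∀ s' ∈ Icc j₁ s, ‖(v c s' - v a s') - u₀‖ ≤ U / 8 := fun s' hs'' ↦ (hmemS s').mp (hsub hs'')
    obtain ⟨ha, hc⟩ := hinca s hs' hclose
    have hlt : ‖(v c s - v a s) - u₀‖ < U / 8 := by
      have h1 : ‖(v c s - v a s) - u₀‖ ≤ ‖v c s - v c j₁‖ + ‖v a s - v a j₁‖ := by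
        calc ‖(v c s - v a s) - u₀‖ = ‖(v c s - v c j₁) - (v a s - v a j₁)‖ := by rw [hu₀]; congr 1; abel
          _ ≤ ‖v c s - v c j₁‖ + ‖v a s - v a j₁‖ := norm_sub_le _ _
      have h2 : 6 * kick / M a + 6 * kick / M c = (6 / M a + 6 / M c) * kick := by ring
      have h3 : 0 < U / 16 := by positivity
      linarith
    have hopen : IsOpen {s' : ℝ | ‖(v c s' - v a s') - u₀‖ < U / 8} := isOpen_lt (by fun_prop) continuous_const
    refine mem_nhdsWithin_of_mem_nhds (Filter.mem_of_superset (hopen.mem_nhds hlt) fun s' hs'' ↦ ?_)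
    rw [hmemS]; exact le_of_lt hs''
  -- conclusions
  have hcloseAll : ∀ s ∈ Icc j₁ j₂, ∀ s' ∈ Icc j₁ s, ‖(v c s' - v a s') - u₀‖ ≤ U / 8 := fun s hs s' hs' ↦
    (hmemS s').mp (hind ⟨hs'.1, hs'.2.trans hs.2⟩)
  exact ⟨fun s hs ↦ (hmemS s).mp (hind hs), fun s hs ↦ (hinca s hs (hcloseAll s hs)).1⟩

/-- Registered one-line helper of this file: the far radius `min(d, 2θs)/3` is positive. [folklore] -/
theorem min_radius_pos : ∀ {d θ s rm : ℝ}, 0 < rm → rm ≤ d → 0 < θ → 0 < s → 0 < min d (2 * θ * s) / 3 :=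
  fun hrm hd hθ hs ↦ div_pos (lt_min (hrm.trans_le hd) (by positivity)) (by norm_num)

end Summit.FinalStateConjecture.FinalStateConjecture.Theorems.SublinearIsFree.Virial

end
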